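import Mathlib
import Summits.QuantumFields.YangMills.Theorems.UniversalDetectorLatticeRiemannPerturbation
import Summits.QuantumFields.YangMills.Theorems.UniversalDetectorLatticeRiemannQ2Shape

/-!
# Route `UniversalDetector`, support item `LimitExtraction` (stmt-QuantumFields-26597): `Q2` template

Ideator seat ym-idea-8 g4.  The two previous pieces combined into the form a lattice-gauge prover plugs into:
* `tendsto_latticeDoubleSum_of_near_kernel` — `UniversalDetectorLatticeRiemannPerturbation` +
  `UniversalDetectorLatticeRiemannQ2Shape`: if the pair functions `Φ_k` (for NT: `a_k^{-8} Cov_k` of the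
  plaquette densities on the torus of side `L_k = Ls (φ k)`, spacing `s_k = a (βs (φ k))`) stay within `M` of
  `K(s_k x' - s_k x)` on the pairs charged by `w₁(s_k x) w₂(s_k x')` and within `ε` on the charged pairs of
  radius `≤ R` (eventually; all `R, ε > 0`), then the weighted sums converge to `∫ x, ∫ y, w₁ x * w₂ y * K (y - x)`
  — the last conjunct of `LimitExtraction` once `Q2 = Σ Σ w₁ w₂ Cov` is rewritten through torus translation
  covariance, (TIGHT) at separation `≥ 2t₀` supplies `M`, and local uniform convergence of the rescaled kernel
  supplies `ε`;
* `integral_nonneg_of_latticeDoubleSum_nonneg` — positivity passes to the limit (the reflection-positivity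
  conjunct: lattice RP of the Wilson measure gives the eventual sign with `w₁ = ϑ w₂`).
No summit, leg or spine statement is proved here.
-/

set_option autoImplicit false

namespace Summit.QuantumFields.YangMills.Cruxes.UniversalDetectorLimitExtraction

open Finset MeasureTheory Filter Topology Literature.Probability.LatticeModels
  Literature.MathematicalPhysics.QuantumLattice

/-- **Template for the `Q2` conjunct of `LimitExtraction`.**  Let `w₁, w₂` be real Schwartz functions with
`tsupport`s in the opposite time slabs `{-y_{i₀} ≥ t₀}`, `{y_{i₀} ≥ t₀}` (`t₀ > 0`), `K` continuous on `{z ≠ 0}`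
and bounded on every `{‖z‖ ≥ η}`, `0 < s_k → 0`, `s_k L_k → ∞`, and let `Φ_k(x,x')` be pair functions on the
boxes (for NT: `a_k^{-8} Cov_k(A_x, A_{x'})`) which, on the pairs charged by `w₁(s_k x) w₂(s_k x')`, stay within
`M` of `K(s_k x' - s_k x)` eventually, and within `ε` of it on the charged pairs of radius `≤ R` eventually
(every `R, ε > 0`).  Then `s_k^{2d} Σ_{x,x'} w₁(s_k x) w₂(s_k x') Φ_k(x,x') → ∫ x, ∫ y, w₁ x * w₂ y * K (y - x)`. -/
theorem tendsto_latticeDoubleSum_of_near_kernel {d : ℕ} (i₀ : Fin d)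
    (w₁ w₂ : SchwartzMap (EuclideanSpace ℝ (Fin d)) ℝ) (K : EuclideanSpace ℝ (Fin d) → ℝ) (t₀ : ℝ)
    (ht₀ : 0 < t₀) (h₁ : tsupport (w₁ : EuclideanSpace ℝ (Fin d) → ℝ) ⊆ {y | t₀ ≤ -(y i₀)})
    (h₂ : tsupport (w₂ : EuclideanSpace ℝ (Fin d) → ℝ) ⊆ {y | t₀ ≤ y i₀})
    (hKc : ContinuousOn K {z | z ≠ 0}) (hKb : ∀ η : ℝ, 0 < η → ∃ C : ℝ, ∀ z, η ≤ ‖z‖ → |K z| ≤ C)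
    (s : ℕ → ℝ) (hs : ∀ k, 0 < s k) (hs0 : Tendsto s atTop (𝓝 0))
    (L : ℕ → ℕ) (hL : Tendsto (fun k => s k * L k) atTop atTop)
    (Φ : ℕ → Site d → Site d → ℝ) (M : ℝ)
    (hM : ∀ᶠ k in atTop, ∀ x ∈ box d (L k), ∀ x' ∈ box d (L k),
      w₁ (s k • siteToE x) ≠ 0 → w₂ (s k • siteToE x') ≠ 0 →
      |Φ k x x' - K (s k • siteToE x' - s k • siteToE x)| ≤ M)
    (hnear : ∀ R ε : ℝ, 0 < R → 0 < ε → ∀ᶠ k in atTop, ∀ x ∈ box d (L k), ∀ x' ∈ box d (L k),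
      ‖s k • siteToE x‖ ≤ R → ‖s k • siteToE x'‖ ≤ R →
      w₁ (s k • siteToE x) ≠ 0 → w₂ (s k • siteToE x') ≠ 0 →
      |Φ k x x' - K (s k • siteToE x' - s k • siteToE x)| ≤ ε) :
    Tendsto (fun k => (s k ^ d) ^ 2 * ∑ x ∈ box d (L k), ∑ x' ∈ box d (L k),
        w₁ (s k • siteToE x) * w₂ (s k • siteToE x') * Φ k x x') atTop
      (𝓝 (∫ x, ∫ y, w₁ x * w₂ y * K (y - x))) := by
  have hs1 : ∀ᶠ k in atTop, s k ≤ 1 := hs0.eventually (ge_mem_nhds zero_lt_one)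
  have hA := tendsto_latticeDoubleSum_perturbation w₁ w₂ Φ
    (fun k x x' => K (s k • siteToE x' - s k • siteToE x)) s hs hs1 L M hM hnear
  have hB := tendsto_latticeDoubleSum_schwartzKernel i₀ w₁ w₂ K t₀ ht₀ h₁ h₂ hKc hKb s hs hs0 L hL
  have h := hA.add hB
  rw [zero_add] at h
  refine h.congr fun k => ?_
  rw [← mul_add, ← sum_add_distrib]
  congr 1
  refine sum_congr rfl fun x _ => ?_
  rw [← sum_add_distrib]
  exact sum_congr rfl fun x' _ => by ring

/-- **Positivity passes to the limit** (the shape of the reflection-positivity conjunct of `LimitExtraction`):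
under the hypotheses of `tendsto_latticeDoubleSum_of_near_kernel`, if the weighted double sums are eventually
non-negative (for NT: lattice reflection positivity of the Wilson measure with `w₁ = ϑw₂`), then
`0 ≤ ∫ x, ∫ y, w₁ x * w₂ y * K (y - x)`. -/
theorem integral_nonneg_of_latticeDoubleSum_nonneg {d : ℕ} (i₀ : Fin d)
    (w₁ w₂ : SchwartzMap (EuclideanSpace ℝ (Fin d)) ℝ) (K : EuclideanSpace ℝ (Fin d) → ℝ) (t₀ : ℝ)
    (ht₀ : 0 < t₀) (h₁ : tsupport (w₁ : EuclideanSpace ℝ (Fin d) → ℝ) ⊆ {y | t₀ ≤ -(y i₀)})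
    (h₂ : tsupport (w₂ : EuclideanSpace ℝ (Fin d) → ℝ) ⊆ {y | t₀ ≤ y i₀})
    (hKc : ContinuousOn K {z | z ≠ 0}) (hKb : ∀ η : ℝ, 0 < η → ∃ C : ℝ, ∀ z, η ≤ ‖z‖ → |K z| ≤ C)
    (s : ℕ → ℝ) (hs : ∀ k, 0 < s k) (hs0 : Tendsto s atTop (𝓝 0))
    (L : ℕ → ℕ) (hL : Tendsto (fun k => s k * L k) atTop atTop)
    (Φ : ℕ → Site d → Site d → ℝ) (M : ℝ)
    (hM : ∀ᶠ k in atTop, ∀ x ∈ box d (L k), ∀ x' ∈ box d (L k),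
      w₁ (s k • siteToE x) ≠ 0 → w₂ (s k • siteToE x') ≠ 0 →
      |Φ k x x' - K (s k • siteToE x' - s k • siteToE x)| ≤ M)
    (hnear : ∀ R ε : ℝ, 0 < R → 0 < ε → ∀ᶠ k in atTop, ∀ x ∈ box d (L k), ∀ x' ∈ box d (L k),
      ‖s k • siteToE x‖ ≤ R → ‖s k • siteToE x'‖ ≤ R →
      w₁ (s k • siteToE x) ≠ 0 → w₂ (s k • siteToE x') ≠ 0 →
      |Φ k x x' - K (s k • siteToE x' - s k • siteToE x)| ≤ ε)
    (hpos : ∀ᶠ k in atTop, 0 ≤ ∑ x ∈ box d (L k), ∑ x' ∈ box d (L k),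
      w₁ (s k • siteToE x) * w₂ (s k • siteToE x') * Φ k x x') :
    0 ≤ ∫ x, ∫ y, w₁ x * w₂ y * K (y - x) := by
  refine ge_of_tendsto (tendsto_latticeDoubleSum_of_near_kernel i₀ w₁ w₂ K t₀ ht₀ h₁ h₂ hKc hKb s hs hs0 L hL
    Φ M hM hnear) ?_
  filter_upwards [hpos] with k hk
  exact mul_nonneg (by positivity) hk

end Summit.QuantumFields.YangMills.Cruxes.UniversalDetectorLimitExtraction
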